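import Summits.QuantumFields.YangMills.Theorems.UnitScaleTiltProp7LinAvgAdjoint
import Literature.MathematicalPhysics.QuantumFieldTheory.Balaban1983to89.B5Eq120IterProof
import HarnessLib

/-!
# Route `UnitScaleTilt`, crux K1 «MinimiserStabilityRegPr» (stmt-QuantumFields-19200), route-R E′ S3, line HKGK-ANALYTIC (★★OWNER g28 22:42:33Z), item (C2-ii) «LINAVG-ITER-ADJOINT»:
# THE k-FOLD TRANSPOSE SENTENCE — against a level-`k` co-closed weight the COMPOSITE of the flat linearised (0.4) averages pairs like `L^k` times the iterated straight
# average `Q_k = bondAvgIter k` of [Balaban1984PropagatorsI] (1.18): every staircase of every level drops out, and the straight parts compose exactly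

Cell `ym3-torus`, width seat `ym3-torus-px12` (gen 4); ★ym-ust-19200-w4 g7 2026-08-28 22:59:06Z «(C2-ii) … same hand if you want it» (after ✓p676318 (C2-i)); ★ym-ust-19200-p1 g16
23:01:04Z standing PASS renewed.  THEOREMS ONLY (0 `def`, 0 `sorry`); `--supports stmt-QuantumFields-19200 --as helper`, count-neutral.  YM₃ on T³ is a ladder rung (R3), not the Clay problem;
nothing here claims the stub, the crux, d = 4 or the mass gap.

THE POINT (★w4 g7 `LOCATE-B1-BERNSTEIN-w4g7.md` §0 item 2 «THE COMPOSITE TELESCOPES»).  Let `Q k` be the `k`-fold composite of the flat one-step linearisations — characterised, in the tree's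
«families by recursion» convention (✓ `Prop7IterLinStructureRec`), by `Q 0 = id` and `Q (j+1) = linAvg ∘ Q j`.  For a weight `ν` on the level-`k` bonds that is WEAKLY CO-CLOSED
(`Σ_c ν(c)•(f(c₊) − f(c₋)) = 0` for every coarse site function `f`; the pointwise form `Σ_μν⟨y,μ⟩ = Σ_μν⟨y−e_μ,μ⟩` implies it, ✓ `Prop7LinAvgAdjoint.sum_smul_coarseGrad_eq_zero`):
    `Σ_c ν(c)•(Q k Y)(c) = L^k·Σ_c ν(c)•(Q_k Y)(c)`,  `Q_k = bondAvgIter k`.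
Induction: the level-`(k+1)` stairs drop by (C2-i); the weight transposed through one straight average `bondAvg` is again weakly co-closed one level down (because `L·bondAvg = linAvg + δ∘combMean`
and `linAvg` maps gradients to COARSE gradients, ✓ `linAvg_grad`), so the induction hypothesis applies to it; and `bondAvg ∘ bondAvgIter k = bondAvgIter (k+1)` by definition
(✓ `B5Eq120IterProof.bondAvgIter_succ`).  With ✓ `B5Eq117TorusCarriers.Qk_tV` ∘ ✓ `B5TowerOneStroke.cplx_Qk` (`bondAvgIter k` = the one-stroke `B5Block118.QvOp (L^k)`), this is what lets
(C5) read the critical multiplier's pairing at ANY level `k` through ONE box–box–tent average at block `L^k` — k-uniformity for free.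

WHAT IS PROVED (ns `…Theorems.Prop7LinAvgIterAdjoint`; any `P : Params`; matrix fields `Matrix n n ℂ`, scalar `ℂ`-weights).
* §1 `sum_smul_apply_eq_sum_fiber` (re-indexing by fibres), `smul_bondAvg_eq` (unfolding `ν•bondAvg X c` over the pairs `(r,t)` with the `ℂ`-factor `(L^{d+1})⁻¹`), ★ `sum_smul_bondAvg_eq_sum_transpose` —
  `Σ_c ν(c)•(bondAvg X)(c) = Σ_b ν♭(b)•X(b)` with the TRANSPOSED WEIGHT `ν♭(b) = Σ_{(c,r,t) : runBond (blockSite c₋ r) c.dir t = b} (L^{d+1})⁻¹ν(c)` written out (def-free `ite`-sum over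
  the triples; `[DecidableEq (PBond P k)]` a hypothesis).
* §2 the WEAK forms of (C2-i): `sum_smul_linAvg_eq_of_wcoclosed`, `sum_smul_linAvg_grad_eq_zero_of_wcoclosed`, and ★ `sum_smul_bondAvg_grad_eq_zero` — a weakly co-closed coarse weight
  pairs to zero with the straight average of every fine gradient (`L ≠ 0`).
* §3 ★ `wcoclosed_transpose` — `ν` weakly co-closed at level `k+1` ⇒ `ν♭` weakly co-closed at level `k`.
* §4 ★★★ `sum_smul_iterLinAvg_eq` — the title sentence for every recursion family `Q`; ★★ `sum_smul_iterLinAvg_eq_of_coclosed` — the same from the POINTWISE co-closedness;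
  ★ `sum_smul_iterLinAvg_grad_eq_zero` — the composite maps fine gradients to something every weakly co-closed weight kills (`GᵀQ^{(k)ᵀ}ν = 0`), via ✓ `bondAvgIter_grad`.
HONEST SCOPE.  Flat, linear, finite sums; no estimate; the (0.4) guards and the second-order remainders of ✓ `norm_avgFun_sub_one_sub_linAvg_le` (which make `Q k` the derivative of the TREE's
k-fold average `descendTo` at `W = 1`) are not restated here — `Q` is the abstract recursion family, as in ✓ `Prop7IterLinStructureRec`.

References: T. Bałaban, CMP 95 (1984) 17–40 [Balaban1984PropagatorsI] ((1.11) p.19, (1.18), (1.20) p.20, (1.21) p.21); CMP 98 (1985) 17–51 [Balaban1985Averaging] ((62) p.28,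
(124)–(125) p.36, (11) p.18); CMP 109 (1987) 249–301 [Balaban1987RG1] ((0.4) p.253).
-/

set_option autoImplicit false

noncomputable section

open scoped BigOperators

namespace Summit.QuantumFields.YangMills.Theorems.Prop7LinAvgIterAdjoint

open Literature.MathematicalPhysics.QuantumFieldTheory.Balaban1983to89
open BlockAveragingEMLLinearised (linAvg combMean linAvg_eq_bondAvg_sub_grad_combMean linAvg_grad)
open LatticeFieldCalculus (bondAvg bondAvgIter segSum runBond grad siteAvgIter)
open B5Eq120IterProof (bondAvgIter_zero bondAvgIter_succ bondAvgIter_grad)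
open Summit.QuantumFields.YangMills.Theorems.Prop7LinAvgAdjoint (sum_smul_coarseGrad_eq_zero)

variable {P : Params} {n : Type*}

/-! ## §1 The straight average transposed onto the weight -/

section Transpose

variable {k : ℕ}

/-- Re-indexing a weighted sum of values `X(φ i)` by the fibres of `φ`: `Σ_i κ_i•X(φ i) = Σ_b (Σ_{i : φ i = b} κ_i)•X(b)`. [folklore] -/
theorem sum_smul_apply_eq_sum_fiber {ι B R M : Type*} [Fintype ι] [Fintype B] [DecidableEq B] [Semiring R] [AddCommMonoid M] [Module R M]
    (φ : ι → B) (κ : ι → R) (X : B → M) :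
    ∑ i, κ i • X (φ i) = ∑ b, (∑ i, if φ i = b then κ i else 0) • X b := by
  simp only [Finset.sum_smul, ite_smul, zero_smul]
  rw [Finset.sum_comm]
  refine Finset.sum_congr rfl fun i _ => ?_
  rw [Finset.sum_ite_eq]
  simp

/-- `ν•(bondAvg X)(c) = Σ_{(r,t)} ((L^{d+1})⁻¹ν)•X(runBond (blockSite c₋ r) c.dir t)` (unfolding (1.11), the real factor moved into the `ℂ`-weight, the segment index as `Fin L`).
[cite: Balaban1984PropagatorsI, (1.11) p.19] -/
theorem smul_bondAvg_eq (ν : ℂ) (X : PBond P k → Matrix n n ℂ) (c : PBond P (k + 1)) :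
    ν • bondAvg X c = ∑ rt : (Fin P.d → Fin P.L) × Fin P.L,
      ((((P.L : ℂ) ^ (P.d + 1))⁻¹ * ν) • X (runBond (Site.blockSite c.src rt.1) c.dir rt.2)) := by
  rw [bondAvg, RCLike.real_smul_eq_coe_smul (K := ℂ), smul_smul, Finset.smul_sum, Fintype.sum_prod_type]
  refine Finset.sum_congr rfl fun r _ => ?_
  rw [segSum, Finset.smul_sum, ← Fin.sum_univ_eq_sum_range]
  refine Finset.sum_congr rfl fun t _ => ?_
  congr 1
  push_cast
  ring

/-- ★ **THE STRAIGHT AVERAGE TRANSPOSED**: `Σ_c ν(c)•(bondAvg X)(c) = Σ_b ν♭(b)•X(b)` with the transposed (box–box–tent) weight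
`ν♭(b) = Σ_{(c,r,t) : runBond (blockSite c₋ r) c.dir t = b} (L^{d+1})⁻¹ν(c)` on the fine bonds (one sum over the triples `(c, r, t)`). [cite: Balaban1984PropagatorsI, (1.11) p.19, (1.21) p.21] -/
theorem sum_smul_bondAvg_eq_sum_transpose [DecidableEq (PBond P k)] (ν : PBond P (k + 1) → ℂ) (X : PBond P k → Matrix n n ℂ) :
    ∑ c : PBond P (k + 1), ν c • bondAvg X c
      = ∑ b : PBond P k, (∑ i : PBond P (k + 1) × ((Fin P.d → Fin P.L) × Fin P.L),
          if runBond (Site.blockSite i.1.src i.2.1) i.1.dir i.2.2 = b then (((P.L : ℂ) ^ (P.d + 1))⁻¹ * ν i.1) else 0) • X b := by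
  rw [← sum_smul_apply_eq_sum_fiber (fun i : PBond P (k + 1) × ((Fin P.d → Fin P.L) × Fin P.L) => runBond (Site.blockSite i.1.src i.2.1) i.1.dir i.2.2)
      (fun i => ((P.L : ℂ) ^ (P.d + 1))⁻¹ * ν i.1) X, Fintype.sum_prod_type]
  exact Finset.sum_congr rfl fun c _ => smul_bondAvg_eq (ν c) X c

end Transpose

/-! ## §2 The weak forms of (C2-i) and the straight average of a gradient -/

section Weak

variable {j : ℕ}

/-- (C2-i) in WEAK form: a weakly co-closed coarse weight sees `Q₁` as `L·Q`. [cite: Balaban1985Averaging, (124)-(125) p.36] -/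
theorem sum_smul_linAvg_eq_of_wcoclosed (ν : PBond P (j + 1) → ℂ)
    (hν : ∀ f : Site P (j + 1) → Matrix n n ℂ, ∑ c : PBond P (j + 1), ν c • (f c.tgt - f c.src) = 0)
    (Y : PBond P j → Matrix n n ℂ) :
    ∑ c : PBond P (j + 1), ν c • linAvg Y c = ∑ c : PBond P (j + 1), ν c • (((P.L : ℕ) : ℂ) • bondAvg Y c) := by
  calc ∑ c : PBond P (j + 1), ν c • linAvg Y c
      = ∑ c : PBond P (j + 1), (ν c • (((P.L : ℕ) : ℂ) • bondAvg Y c) - ν c • (combMean Y c.tgt - combMean Y c.src)) := by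
        refine Finset.sum_congr rfl fun c _ => ?_
        rw [linAvg_eq_bondAvg_sub_grad_combMean, smul_sub]
    _ = ∑ c : PBond P (j + 1), ν c • (((P.L : ℕ) : ℂ) • bondAvg Y c) := by
        rw [Finset.sum_sub_distrib, hν (combMean Y), sub_zero]

/-- (C2-i)'s gauge half in WEAK form: `Σ_c ν(c)•Q₁(dλ)(c) = 0`. [cite: Balaban1985Averaging, (11) p.18] -/
theorem sum_smul_linAvg_grad_eq_zero_of_wcoclosed (ν : PBond P (j + 1) → ℂ)
    (hν : ∀ f : Site P (j + 1) → Matrix n n ℂ, ∑ c : PBond P (j + 1), ν c • (f c.tgt - f c.src) = 0)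
    (lam : Site P j → Matrix n n ℂ) :
    ∑ c : PBond P (j + 1), ν c • linAvg (fun b : PBond P j => lam b.tgt - lam b.src) c = 0 := by
  calc ∑ c : PBond P (j + 1), ν c • linAvg (fun b : PBond P j => lam b.tgt - lam b.src) c
      = ∑ c : PBond P (j + 1), ν c • (lam (emb c.tgt) - lam (emb c.src)) := by
        refine Finset.sum_congr rfl fun c _ => ?_
        rw [linAvg_grad]
    _ = 0 := hν (fun y => lam (emb y))

/-- ★ **A WEAKLY CO-CLOSED COARSE WEIGHT KILLS THE STRAIGHT AVERAGE OF EVERY FINE GRADIENT**: `Σ_c ν(c)•(bondAvg (dλ))(c) = 0` — because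
`L·bondAvg(dλ) = Q₁(dλ) + δ(combMean(dλ))`, a coarse gradient read at the centres plus a coarse gradient. [cite: Balaban1984PropagatorsI, (1.13) p.19; Balaban1985Averaging, (11) p.18] -/
theorem sum_smul_bondAvg_grad_eq_zero (ν : PBond P (j + 1) → ℂ)
    (hν : ∀ f : Site P (j + 1) → Matrix n n ℂ, ∑ c : PBond P (j + 1), ν c • (f c.tgt - f c.src) = 0)
    (lam : Site P j → Matrix n n ℂ) :
    ∑ c : PBond P (j + 1), ν c • bondAvg (fun b : PBond P j => lam b.tgt - lam b.src) c = 0 := by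
  have hL : ((P.L : ℕ) : ℂ) ≠ 0 := Nat.cast_ne_zero.mpr P.L_pos.ne'
  -- `L •` the sum vanishes
  have h1 : ∑ c : PBond P (j + 1), ν c • (((P.L : ℕ) : ℂ) • bondAvg (fun b : PBond P j => lam b.tgt - lam b.src) c) = 0 := by
    have e : ∀ c : PBond P (j + 1), ν c • (((P.L : ℕ) : ℂ) • bondAvg (fun b : PBond P j => lam b.tgt - lam b.src) c)
        = ν c • linAvg (fun b : PBond P j => lam b.tgt - lam b.src) c
          + ν c • (combMean (fun b : PBond P j => lam b.tgt - lam b.src) c.tgt - combMean (fun b : PBond P j => lam b.tgt - lam b.src) c.src) := by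
      intro c
      rw [linAvg_eq_bondAvg_sub_grad_combMean, ← smul_add, sub_add_cancel]
    simp only [e, Finset.sum_add_distrib]
    rw [sum_smul_linAvg_grad_eq_zero_of_wcoclosed ν hν lam, hν, add_zero]
  have h2 : ∑ c : PBond P (j + 1), ν c • (((P.L : ℕ) : ℂ) • bondAvg (fun b : PBond P j => lam b.tgt - lam b.src) c)
      = ((P.L : ℕ) : ℂ) • ∑ c : PBond P (j + 1), ν c • bondAvg (fun b : PBond P j => lam b.tgt - lam b.src) c := by
    rw [Finset.smul_sum]
    exact Finset.sum_congr rfl fun c _ => smul_comm _ _ _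
  rw [h2] at h1
  exact (smul_eq_zero.mp h1).resolve_left hL

end Weak

/-! ## §3 The transposed weight is again weakly co-closed -/

section TransposeCoclosed

variable {k : ℕ}

/-- ★ **ONE LEVEL DOWN**: if `ν` is weakly co-closed on the level-`(k+1)` bonds, its transpose `ν♭` through the straight average is weakly co-closed on the level-`k` bonds.
[cite: Balaban1984PropagatorsI, (1.13) p.19, (1.21) p.21] -/
theorem wcoclosed_transpose [DecidableEq (PBond P k)] (ν : PBond P (k + 1) → ℂ)
    (hν : ∀ f : Site P (k + 1) → Matrix n n ℂ, ∑ c : PBond P (k + 1), ν c • (f c.tgt - f c.src) = 0)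
    (f : Site P k → Matrix n n ℂ) :
    ∑ b : PBond P k, (∑ i : PBond P (k + 1) × ((Fin P.d → Fin P.L) × Fin P.L),
        if runBond (Site.blockSite i.1.src i.2.1) i.1.dir i.2.2 = b then (((P.L : ℂ) ^ (P.d + 1))⁻¹ * ν i.1) else 0) • (f b.tgt - f b.src) = 0 := by
  rw [← sum_smul_bondAvg_eq_sum_transpose ν (fun b : PBond P k => f b.tgt - f b.src)]
  exact sum_smul_bondAvg_grad_eq_zero ν hν f

end TransposeCoclosed

/-! ## §4 ★★★ The k-fold transpose sentence -/

section Iter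

/-- ★★★ **THE COMPOSITE TELESCOPES ON CO-CLOSED WEIGHTS.**  For every family `Q` with `Q 0 = id` and `Q (j+1) = linAvg ∘ Q j` (the `k`-fold composite of the flat linearised
(0.4) averages), every `k`, every WEAKLY co-closed weight `ν` on the level-`k` bonds and every matrix bond field `Y` on the finest lattice:
`Σ_c ν(c)•(Q k Y)(c) = Σ_c ν(c)•(L^k·(Q_k Y)(c))`, `Q_k = bondAvgIter k` ((1.18)).  [cite: Balaban1984PropagatorsI, (1.18) p.20; Balaban1985Averaging, (124)-(125) p.36] -/
theorem sum_smul_iterLinAvg_eq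
    (Q : (k : ℕ) → (PBond P 0 → Matrix n n ℂ) → (PBond P k → Matrix n n ℂ))
    (hQ0 : ∀ Y, Q 0 Y = Y) (hQs : ∀ (j : ℕ) (Y) (c : PBond P (j + 1)), Q (j + 1) Y c = linAvg (Q j Y) c) :
    ∀ (k : ℕ) (ν : PBond P k → ℂ),
      (∀ f : Site P k → Matrix n n ℂ, ∑ c : PBond P k, ν c • (f c.tgt - f c.src) = 0) →
      ∀ Y : PBond P 0 → Matrix n n ℂ,
        ∑ c : PBond P k, ν c • Q k Y c = ∑ c : PBond P k, ν c • (((P.L : ℂ) ^ k) • bondAvgIter k Y c)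
  | 0, ν, _, Y => by simp [hQ0, bondAvgIter_zero]
  | k + 1, ν, hν, Y => by
    classical
    -- the level-(k+1) stairs drop
    have h1 : ∑ c : PBond P (k + 1), ν c • Q (k + 1) Y c = ∑ c : PBond P (k + 1), ν c • (((P.L : ℕ) : ℂ) • bondAvg (Q k Y) c) := by
      rw [← sum_smul_linAvg_eq_of_wcoclosed ν hν (Q k Y)]
      exact Finset.sum_congr rfl fun c _ => by rw [hQs]
    -- pull `L` out, transpose the straight average onto the weight, use the induction hypothesis one level down, transpose back
    have hT := fun X : PBond P k → Matrix n n ℂ => sum_smul_bondAvg_eq_sum_transpose ν X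
    have hW := wcoclosed_transpose (n := n) ν hν
    have ih := sum_smul_iterLinAvg_eq Q hQ0 hQs k _ hW Y
    calc ∑ c : PBond P (k + 1), ν c • Q (k + 1) Y c
        = ((P.L : ℕ) : ℂ) • ∑ c : PBond P (k + 1), ν c • bondAvg (Q k Y) c := by
          rw [h1, Finset.smul_sum]; exact Finset.sum_congr rfl fun c _ => smul_comm _ _ _
      _ = ((P.L : ℕ) : ℂ) • ∑ c : PBond P (k + 1), ν c • bondAvg (fun b => ((P.L : ℂ) ^ k) • bondAvgIter k Y b) c := by
          rw [hT (Q k Y), ih, ← hT (fun b => ((P.L : ℂ) ^ k) • bondAvgIter k Y b)]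
      _ = ((P.L : ℕ) : ℂ) • ∑ c : PBond P (k + 1), ν c • (((P.L : ℂ) ^ k) • bondAvg (bondAvgIter k Y) c) := by
          congr 1
          refine Finset.sum_congr rfl fun c _ => ?_
          congr 1
          -- `bondAvg` is linear: it commutes with the constant scalar `L^k`
          simp only [bondAvg, segSum, Finset.smul_sum, smul_comm (((P.L : ℂ) ^ k))]
      _ = ∑ c : PBond P (k + 1), ν c • (((P.L : ℂ) ^ (k + 1)) • bondAvgIter (k + 1) Y c) := by
          rw [Finset.smul_sum]
          refine Finset.sum_congr rfl fun c _ => ?_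
          rw [bondAvgIter_succ, smul_smul, smul_smul, smul_smul]
          congr 1
          ring

/-- ★★ **THE SAME FROM POINTWISE CO-CLOSEDNESS** `Σ_μ ν⟨y,μ⟩ = Σ_μ ν⟨y − e_μ, μ⟩` (✓ `Prop7LinAvgAdjoint.sum_smul_coarseGrad_eq_zero` gives the weak form).
[cite: Balaban1984PropagatorsI, (1.18) p.20, (1.21) p.21] -/
theorem sum_smul_iterLinAvg_eq_of_coclosed
    (Q : (k : ℕ) → (PBond P 0 → Matrix n n ℂ) → (PBond P k → Matrix n n ℂ))
    (hQ0 : ∀ Y, Q 0 Y = Y) (hQs : ∀ (j : ℕ) (Y) (c : PBond P (j + 1)), Q (j + 1) Y c = linAvg (Q j Y) c)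
    (k : ℕ) (ν : PBond P k → ℂ) (hν : ∀ y : Site P k, ∑ μ : Fin P.d, ν ⟨y, μ⟩ = ∑ μ : Fin P.d, ν ⟨y.unshift μ, μ⟩)
    (Y : PBond P 0 → Matrix n n ℂ) :
    ∑ c : PBond P k, ν c • Q k Y c = ∑ c : PBond P k, ν c • (((P.L : ℂ) ^ k) • bondAvgIter k Y c) :=
  sum_smul_iterLinAvg_eq Q hQ0 hQs k ν (fun f => sum_smul_coarseGrad_eq_zero (R := ℂ) (M := Matrix n n ℂ) ν hν f) Y

/-- ★ **THE COMPOSITE MAPS GRADIENTS INTO THE ANNIHILATOR OF CO-CLOSED WEIGHTS** (`GᵀQ^{(k)ᵀ}ν = 0`): for a weakly co-closed level-`k` weight `ν` and every fine site function `λ`,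
`Σ_c ν(c)•(Q k (∂λ))(c) = 0` (`∂λ = grad 1 λ`; ✓ `bondAvgIter_grad`: `Q_k(∂λ) = ∂_{L^{−k}}(Q′_kλ)`, a coarse gradient). [cite: Balaban1984PropagatorsI, (1.20) p.20] -/
theorem sum_smul_iterLinAvg_grad_eq_zero
    (Q : (k : ℕ) → (PBond P 0 → Matrix n n ℂ) → (PBond P k → Matrix n n ℂ))
    (hQ0 : ∀ Y, Q 0 Y = Y) (hQs : ∀ (j : ℕ) (Y) (c : PBond P (j + 1)), Q (j + 1) Y c = linAvg (Q j Y) c)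
    (k : ℕ) (hk : k ≤ P.m + P.K) (ν : PBond P k → ℂ)
    (hν : ∀ f : Site P k → Matrix n n ℂ, ∑ c : PBond P k, ν c • (f c.tgt - f c.src) = 0)
    (lam : Site P 0 → Matrix n n ℂ) :
    ∑ c : PBond P k, ν c • Q k (grad 1 lam) c = 0 := by
  rw [sum_smul_iterLinAvg_eq Q hQ0 hQs k ν hν, bondAvgIter_grad k hk]
  have e : ∀ c : PBond P k, ν c • (((P.L : ℂ) ^ k) • grad (1 / (P.L : ℝ) ^ k) (siteAvgIter k lam) c)
      = ν c • ((((P.L : ℂ) ^ k) * (((1 / (P.L : ℝ) ^ k : ℝ) : ℂ))) • siteAvgIter k lam c.tgt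
          - (((P.L : ℂ) ^ k) * (((1 / (P.L : ℝ) ^ k : ℝ) : ℂ))) • siteAvgIter k lam c.src) := by
    intro c
    congr 1
    show ((P.L : ℂ) ^ k) • ((1 / (P.L : ℝ) ^ k) • (siteAvgIter k lam c.tgt - siteAvgIter k lam c.src)) = _
    rw [RCLike.real_smul_eq_coe_smul (K := ℂ), smul_smul, smul_sub]
    rfl
  simp only [e]
  exact hν (fun y => (((P.L : ℂ) ^ k) * (((1 / (P.L : ℝ) ^ k : ℝ) : ℂ))) • siteAvgIter k lam y)

end Iter

end Summit.QuantumFields.YangMills.Theorems.Prop7LinAvgIterAdjoint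

end
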